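import Mathlib.NumberTheory.Chebyshev
import Mathlib.NumberTheory.AbelSummation
import Mathlib.NumberTheory.Harmonic.EulerMascheroni
import Mathlib.Analysis.SpecialFunctions.Stirling
import Literature.NumberTheory.Sieve.ParityBarrierProofs
import HarnessLib

/-!
# Selberg's asymptotic formula `∑_{n ≤ x} Λ₂(n) = 2x log x + O(x)` (elementary, explicit)

Topic `Literature/NumberTheory/Sieve` (the parity phenomenon: Selberg's weights `Λ₂ = Λ log + Λ ⋆ Λ`
count `P₂`-numbers and primes with the same asymptotics, [FriedlanderIwaniecPisa1978] §1;
`ParityBarrier.lean`). Everything here is PROVED, with explicit (crude) constants, following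
Apostol, *Introduction to Analytic Number Theory* (1976) [Apostol1976], §4.11 (the method of
Tatuzawa–Iseki):

* `abs_sum_vonMangoldt_div_sub_log_le` — Mertens: `|∑_{n ≤ x} Λ(n)/n − log x| ≤ 6` for `x ≥ 1`
  ([Apostol1976] Thm 4.9 `∑_{n ≤ x} Λ(n)/n = log x + O(1)`; here from Chebyshev's identity
  `log ⌊x⌋! = ∑_{d ≤ x} Λ(d) ⌊x/d⌋`, the crude Stirling bounds `N log N − N ≤ log N! ≤ N log N` and
  Mathlib's Chebyshev bound `ψ(x) ≤ (log 4 + 4) x`);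
* `abs_log_factorial_sub_sum_le` — `|log ⌊y⌋! − ∑_{m ≤ y} (y/m − γ − 1)| ≤ 4 (1 + log y)`
  ([Apostol1976] Thm 3.15 / Thm 4.11 `∑_{n ≤ x} ψ(x/n) = log ⌊x⌋! = x log x − x + O(log x)` and
  Thm 3.2 (a) `∑_{n ≤ x} 1/n = log x + γ + O(1/x)`; here from Mathlib's Stirling bounds and its
  `eulerMascheroniSeq < γ < eulerMascheroniSeq'`);
* `moebius_inversion_log` — the generalised Möbius inversion [Apostol1976] Thm 4.17:
  `F(x) log x + ∑_{n ≤ x} Λ(n) F(x/n) = ∑_{d ≤ x} μ(d) log(x/d) ∑_{m ≤ x/d} F(x/(dm))`;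
* `selberg_symmetry_formula` — [Apostol1976] Thm 4.18 (Selberg 1949):
  `|ψ(x) log x + ∑_{n ≤ x} Λ(n) ψ(x/n) − 2x log x| ≤ 164 x` for `x ≥ 1`;
* `selberg_symmetry_formula'`, `abs_sum_generalizedVonMangoldt_two_sub_le` — the same with
  `∑_{n ≤ x} Λ(n) log n + ∑_{n ≤ x} (Λ ⋆ Λ)(n)`, i.e. `|∑_{n ≤ x} Λ₂(n) − 2x log x| ≤ 170 x`
  (`Λ₂ = Literature.generalizedVonMangoldt 2`), via the partial summation
  `∑_{n ≤ x} Λ(n) log n = ψ(x) log x − ∫_1^x ψ(t) dt/t` (`sum_mul_log_eq`, Mathlib's Abel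
  summation `sum_mul_eq_sub_integral_mul₀`).

The last statement is the case `k = 2`, `a_n = 1` of Bombieri's asymptotic sieve and the base of
the induction proving [FriedlanderIwaniecPisa1978] Lemma 3 for `K = ℚ`
(`BombieriAsymptoticSieveLemma3.lean`). No form of the prime number theorem is used.

## Mathlib

Used: `Chebyshev.psi` (`psi_le_const_mul_self`, `psi_eq_sum_Icc`), `ArithmeticFunction.vonMangoldt`
(`vonMangoldt_mul_zeta`, `zeta_mul_vonMangoldt`, `coe_moebius_mul_coe_zeta`,
`sum_Ioc_mul_eq_sum_sum`, `sum_Ioc_mul_zeta_eq_sum`), `Stirling.le_log_factorial_stirling`,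
`Stirling.log_stirlingSeq'_antitone`, `Real.eulerMascheroniConstant` with its two-sided bounds,
`harmonic_eq_sum_Icc`, `sum_mul_eq_sub_integral_mul₀` (Abel summation),
`norm_setIntegral_le_of_norm_le_const`; and `Literature.NumberTheory.Sieve.sum_Ioc_mul_apply_mul_eq_sum_sum`,
`Literature.NumberTheory.Sieve.moebius_pmul_log`, `Literature.NumberTheory.Sieve.generalizedVonMangoldt_succ` of `ParityBarrierProofs.lean`. Mathlib
(pinned) has Chebyshev's bounds but neither Mertens' `∑ Λ(n)/n` nor Selberg's formula
(`rg "Selberg" Mathlib/NumberTheory`: only `SelbergSieve`).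
-/

noncomputable section

open Finset MeasureTheory ArithmeticFunction
open scoped ArithmeticFunction.Moebius ArithmeticFunction.zeta Chebyshev Nat

namespace Literature.NumberTheory.Sieve

namespace SelbergSymmetry

/-! ### `log N!` -/

/-- `log N! = ∑_{n ≤ N} log n`. [folklore] -/
theorem log_factorial_eq_sum_log (N : ℕ) :
    Real.log (N ! : ℝ) = ∑ n ∈ Ioc 0 N, Real.log n := by
  induction N with
  | zero => simp
  | succ N ih =>
    rw [Nat.factorial_succ, Nat.cast_mul, Real.log_mul (by positivity) (by positivity), ih,
      Finset.sum_Ioc_succ_top (Nat.zero_le N)]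
    ring

/-- **Chebyshev's identity** `log N! = ∑_{d ≤ N} Λ(d) ⌊N/d⌋` (sum `∑_{d ∣ n} Λ(d) = log n` over
`n ≤ N`; Mathlib's `vonMangoldt_mul_zeta` and `sum_Ioc_mul_zeta_eq_sum`).
[cite: Apostol1976, Thm 3.15 / eq. (22) of §4.7] -/
theorem log_factorial_eq_sum_vonMangoldt_mul_div (N : ℕ) :
    Real.log (N ! : ℝ) = ∑ d ∈ Ioc 0 N, Λ d * ((N / d : ℕ) : ℝ) := by
  rw [log_factorial_eq_sum_log, ← sum_Ioc_mul_zeta_eq_sum Λ N, vonMangoldt_mul_zeta]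
  simp only [log_apply]

/-- `N log N − N ≤ log N!` for `N ≥ 1` (Mathlib's Stirling lower bound
`Stirling.le_log_factorial_stirling`, dropping `½ log N + ½ log 2π ≥ 0`). [folklore] -/
theorem log_factorial_ge {N : ℕ} (hN : N ≠ 0) :
    (N : ℝ) * Real.log N - N ≤ Real.log (N ! : ℝ) := by
  have h := Stirling.le_log_factorial_stirling hN
  have h1 : 0 ≤ Real.log N := Real.log_natCast_nonneg N
  have h2 : 0 ≤ Real.log (2 * Real.pi) := Real.log_nonneg (by linarith [Real.pi_gt_three])
  linarith

/-- `log N! ≤ N log N` (`N! ≤ N^N`, Mathlib's `Nat.factorial_le_pow`). [folklore] -/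
theorem log_factorial_le_mul_log (N : ℕ) : Real.log (N ! : ℝ) ≤ N * Real.log N := by
  have h : ((N ! : ℕ) : ℝ) ≤ (N : ℝ) ^ N := by exact_mod_cast Nat.factorial_le_pow N
  rcases Nat.eq_zero_or_pos N with rfl | hN
  · simp
  · calc Real.log (N ! : ℝ) ≤ Real.log ((N : ℝ) ^ N) := Real.log_le_log (by positivity) h
      _ = N * Real.log N := by rw [Real.log_pow]

/-- `log N! ≤ N log N − N + ½ log N + 1`: the Stirling sequence `N!/(√(2N) (N/e)^N)` decreases
(Mathlib's `Stirling.log_stirlingSeq'_antitone`), so it is at most its value `e/√2` at `N = 1`.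
[folklore] -/
theorem log_factorial_le (N : ℕ) :
    Real.log (N ! : ℝ) ≤ N * Real.log N - N + Real.log N / 2 + 1 := by
  rcases Nat.eq_zero_or_pos N with rfl | hN
  · simp
  · obtain ⟨n, rfl⟩ : ∃ n, N = n + 1 := ⟨N - 1, by omega⟩
    have hanti := Stirling.log_stirlingSeq'_antitone (Nat.zero_le n)
    simp only [Function.comp_apply, Nat.succ_eq_add_one, zero_add] at hanti
    rw [Stirling.log_stirlingSeq_formula, Stirling.log_stirlingSeq_formula] at hanti
    have hm0 : ((n + 1 : ℕ) : ℝ) ≠ 0 := by positivity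
    have e1 : Real.log (2 * ((n + 1 : ℕ) : ℝ)) = Real.log 2 + Real.log ((n + 1 : ℕ) : ℝ) :=
      Real.log_mul two_ne_zero hm0
    have e2 : Real.log (((n + 1 : ℕ) : ℝ) / Real.exp 1) = Real.log ((n + 1 : ℕ) : ℝ) - 1 := by
      rw [Real.log_div hm0 (Real.exp_ne_zero 1), Real.log_exp]
    have e3 : Real.log (2 * ((1 : ℕ) : ℝ)) = Real.log 2 := by norm_num
    have e4 : Real.log (((1 : ℕ) : ℝ) / Real.exp 1) = -1 := by
      rw [Nat.cast_one, Real.log_div one_ne_zero (Real.exp_ne_zero 1), Real.log_one, Real.log_exp]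
      ring
    rw [e1, e2] at hanti
    rw [e3, e4, Nat.factorial_one] at hanti
    simp only [Nat.cast_one, Real.log_one, one_mul] at hanti
    nlinarith [hanti]

/-! ### Mertens: `∑_{n ≤ x} Λ(n)/n = log x + O(1)` -/

/-- `log 4 < 2` (`4 < e²`). [folklore] -/
theorem log_four_lt_two : Real.log 4 < 2 := by
  rw [Real.log_lt_iff_lt_exp (by norm_num)]
  have h2 : Real.exp 2 = Real.exp 1 * Real.exp 1 := by rw [← Real.exp_add]; norm_num
  nlinarith [Real.exp_one_gt_d9, Real.exp_pos 1]

/-- **Mertens' estimate for `Λ`** ([Apostol1976] Thm 4.9: "for all `x ≥ 1`,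
`∑_{n ≤ x} Λ(n)/n = log x + O(1)`"), explicit form `|∑_{n ≤ x} Λ(n)/n − log x| ≤ 6` for `x ≥ 1`.
Proof (Chebyshev): `x ∑ Λ(d)/d − ψ(x) ≤ ∑_{d ≤ x} Λ(d) ⌊x/d⌋ = log ⌊x⌋! ≤ x ∑ Λ(d)/d`, with
`N log N − N ≤ log N! ≤ N log N` (`N = ⌊x⌋`) and `ψ(x) ≤ (log 4 + 4) x`
(Mathlib's `Chebyshev.psi_le_const_mul_self`). [cite: Apostol1976, Thm 4.9] -/
theorem abs_sum_vonMangoldt_div_sub_log_le {x : ℝ} (hx : 1 ≤ x) :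
    |∑ n ∈ Ioc 0 ⌊x⌋₊, Λ n / n - Real.log x| ≤ 6 := by
  set N := ⌊x⌋₊ with hN
  have hx0 : 0 < x := by linarith
  have hN1 : 1 ≤ N := Nat.le_floor (by simpa using hx)
  have hNx : (N : ℝ) ≤ x := Nat.floor_le hx0.le
  have hxN : x < N + 1 := Nat.lt_floor_add_one x
  have hid := log_factorial_eq_sum_vonMangoldt_mul_div N
  have hfl : ∀ d ∈ Ioc 0 N, ((N / d : ℕ) : ℝ) ≤ x / d ∧ x / d - 1 ≤ ((N / d : ℕ) : ℝ) := by
    intro d hd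
    have : N / d = ⌊x / d⌋₊ := by rw [hN, Nat.floor_div_natCast]
    rw [this]
    have hxd : 0 ≤ x / d := by positivity
    exact ⟨Nat.floor_le hxd, by linarith [Nat.lt_floor_add_one (x / d)]⟩
  set M := ∑ n ∈ Ioc 0 N, Λ n / n with hM
  have hup : x * M ≤ Real.log (N ! : ℝ) + ψ x := by
    rw [hid, hM, Chebyshev.psi, ← hN, Finset.mul_sum, ← Finset.sum_add_distrib]
    refine Finset.sum_le_sum fun d hd => ?_
    have hd0 : (0 : ℝ) < d := by exact_mod_cast (mem_Ioc.mp hd).1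
    have hΛ : 0 ≤ Λ d := vonMangoldt_nonneg
    have h2 := (hfl d hd).2
    calc x * (Λ d / d) = Λ d * (x / d) := by ring
      _ ≤ Λ d * (((N / d : ℕ) : ℝ) + 1) := mul_le_mul_of_nonneg_left (by linarith) hΛ
      _ = Λ d * ((N / d : ℕ) : ℝ) + Λ d := by ring
  have hlo : Real.log (N ! : ℝ) ≤ x * M := by
    rw [hid, hM, Finset.mul_sum]
    refine Finset.sum_le_sum fun d hd => ?_
    have hd0 : (0 : ℝ) < d := by exact_mod_cast (mem_Ioc.mp hd).1
    calc Λ d * ((N / d : ℕ) : ℝ) ≤ Λ d * (x / d) :=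
          mul_le_mul_of_nonneg_left (hfl d hd).1 vonMangoldt_nonneg
      _ = x * (Λ d / d) := by ring
  have hψ : ψ x ≤ (Real.log 4 + 4) * x := Chebyshev.psi_le_const_mul_self hx0.le
  have hfac_le := log_factorial_le_mul_log N
  have hfac_ge : (N : ℝ) * Real.log N - N ≤ Real.log (N ! : ℝ) := log_factorial_ge (by omega)
  have hlogN0 : 0 ≤ Real.log N := Real.log_natCast_nonneg N
  have hlogN : Real.log N ≤ Real.log x := Real.log_le_log (by exact_mod_cast hN1) hNx
  have hlog2 : Real.log 2 ≤ 1 := by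
    have := Real.log_two_lt_d9; linarith
  have hlogx : Real.log x ≤ Real.log N + Real.log 2 := by
    rw [← Real.log_mul (by positivity) two_ne_zero]
    have h1N : (1 : ℝ) ≤ N := by exact_mod_cast hN1
    exact Real.log_le_log hx0 (by linarith)
  have hlogx_nn : 0 ≤ Real.log x := Real.log_nonneg hx
  have hlogx_le : Real.log x ≤ x := (Real.log_le_sub_one_of_pos hx0).trans (by linarith)
  have h4 := log_four_lt_two
  rw [abs_le]
  constructor
  · -- lower bound
    have h1 : (x - 1) * Real.log N ≤ N * Real.log N :=
      mul_le_mul_of_nonneg_right (by linarith) hlogN0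
    have h2 : (x - 1) * (Real.log x - Real.log 2) ≤ (x - 1) * Real.log N :=
      mul_le_mul_of_nonneg_left (by linarith) (by linarith)
    have h3 : (x - 1) * (Real.log x - Real.log 2) =
        x * Real.log x - x * Real.log 2 - Real.log x + Real.log 2 := by ring
    have h5 : x * Real.log 2 ≤ x * 1 := mul_le_mul_of_nonneg_left hlog2 hx0.le
    have hlog2_nn : 0 ≤ Real.log 2 := Real.log_nonneg one_le_two
    have key : x * (Real.log x - 3) ≤ x * M := by nlinarith
    have := le_of_mul_le_mul_left key hx0
    linarith
  · -- upper bound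
    have h1 : (N : ℝ) * Real.log N ≤ x * Real.log x := mul_le_mul hNx hlogN hlogN0 hx0.le
    have key : x * M ≤ x * (Real.log x + 6) := by nlinarith
    have := le_of_mul_le_mul_left key hx0
    linarith

/-! ### `∑_{m ≤ y} (y/m − γ − 1)` versus `log ⌊y⌋!` -/

/-- `H_N = ∑_{0 < m ≤ N} 1/m` in `ℝ` (Mathlib's `harmonic_eq_sum_Icc`). [folklore] -/
theorem harmonic_eq_sum_Ioc (N : ℕ) : (harmonic N : ℝ) = ∑ m ∈ Ioc 0 N, (m : ℝ)⁻¹ := by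
  have hI : Finset.Icc 1 N = Finset.Ioc 0 N := by
    ext m
    simp only [Finset.mem_Icc, Finset.mem_Ioc]
    omega
  rw [harmonic_eq_sum_Icc, hI]
  push_cast
  rfl

/-- `∑_{m ≤ N} (y/m − γ − 1) = y H_N − (γ + 1) N`. [folklore] -/
theorem sum_div_sub_eq {y : ℝ} (N : ℕ) (γ : ℝ) :
    ∑ m ∈ Ioc 0 N, (y / m - γ - 1) = y * (harmonic N : ℝ) - (γ + 1) * N := by
  rw [harmonic_eq_sum_Ioc, Finset.mul_sum]
  simp only [Finset.sum_sub_distrib, Finset.sum_const, Nat.card_Ioc, Nat.sub_zero, nsmul_eq_mul,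
    mul_one, div_eq_mul_inv]
  ring

/-- **`G₁ − G₂` in the proof of [Apostol1976] Thm 4.18**: for `y ≥ 1`,
`|log ⌊y⌋! − ∑_{m ≤ y} (y/m − γ − 1)| ≤ 4 (1 + log y)`, `γ` = Euler's constant
(`Real.eulerMascheroniConstant`). Apostol: `∑_{n ≤ y} ψ(y/n) = log ⌊y⌋! = y log y − y + O(log y)`
(Thm 3.15, Thm 4.11) and `∑_{n ≤ y} (y/n − γ − 1) = y log y − y + O(1)` (Thm 3.2 (a)); here:
`|log N! − (N log N − N)| ≤ ½ log N + 1` (Stirling, `log_factorial_ge`, `log_factorial_le`) and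
`log N < H_N − γ < log(N + 1) ≤ log N + 1/N` (Mathlib's `eulerMascheroniConstant_lt_eulerMascheroniSeq'`,
`eulerMascheroniSeq_lt_eulerMascheroniConstant`), `N = ⌊y⌋`.
[cite: Apostol1976, Thm 4.18 (proof), Thm 3.15, Thm 3.2 (a)] -/
theorem abs_log_factorial_sub_sum_le {y : ℝ} (hy : 1 ≤ y) :
    |Real.log (⌊y⌋₊ ! : ℝ) -
        ∑ m ∈ Ioc 0 ⌊y⌋₊, (y / m - Real.eulerMascheroniConstant - 1)| ≤
      4 * (1 + Real.log y) := by
  set N := ⌊y⌋₊ with hN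
  set γ := Real.eulerMascheroniConstant with hγ
  have hy0 : 0 < y := by linarith
  have hN1 : 1 ≤ N := Nat.le_floor (by simpa using hy)
  have hN0 : N ≠ 0 := by omega
  have hNy : (N : ℝ) ≤ y := Nat.floor_le hy0.le
  have hyN : y < N + 1 := Nat.lt_floor_add_one y
  have h1N : (1 : ℝ) ≤ N := by exact_mod_cast hN1
  have hN0' : (0 : ℝ) < N := by linarith
  have hγ1 : (harmonic N : ℝ) - Real.log (N + 1) < γ := by
    have := Real.eulerMascheroniSeq_lt_eulerMascheroniConstant N
    simpa [Real.eulerMascheroniSeq] using this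
  have hγ2 : γ < (harmonic N : ℝ) - Real.log N := by
    have := Real.eulerMascheroniConstant_lt_eulerMascheroniSeq' N
    rw [Real.eulerMascheroniSeq', if_neg hN0] at this
    exact this
  have hlogN1 : Real.log (N + 1) ≤ Real.log N + 1 / N := by
    have h1 : Real.log (N + 1) - Real.log N = Real.log (1 + 1 / N) := by
      rw [← Real.log_div (by positivity) hN0'.ne']
      congr 1
      field_simp
    have h2 : Real.log (1 + 1 / N) ≤ 1 / N := by
      have := Real.log_le_sub_one_of_pos (show (0 : ℝ) < 1 + 1 / N by positivity)
      linarith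
    linarith
  have hfac_le := log_factorial_le N
  have hfac_ge : (N : ℝ) * Real.log N - N ≤ Real.log (N ! : ℝ) := log_factorial_ge hN0
  have hlogN0 : 0 ≤ Real.log N := Real.log_natCast_nonneg N
  have hlogN : Real.log N ≤ Real.log y := Real.log_le_log hN0' hNy
  have hγ0 : 0 < γ := lt_trans (by norm_num) Real.one_half_lt_eulerMascheroniConstant
  have hγ23 : γ < 2 / 3 := Real.eulerMascheroniConstant_lt_two_thirds
  have hyN2 : y * (1 / N) ≤ 2 := by
    rw [mul_one_div, div_le_iff₀ hN0']
    linarith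
  have hlogy : 0 ≤ Real.log y := Real.log_nonneg hy
  have ha : (N : ℝ) * Real.log N ≤ y * Real.log N := mul_le_mul_of_nonneg_right hNy hlogN0
  have hb : y * Real.log N ≤ (N + 1) * Real.log N := mul_le_mul_of_nonneg_right hyN.le hlogN0
  have hc : (N : ℝ) * γ ≤ y * γ := mul_le_mul_of_nonneg_right hNy hγ0.le
  have hd : y * γ ≤ (N + 1) * γ := mul_le_mul_of_nonneg_right hyN.le hγ0.le
  rw [sum_div_sub_eq, abs_le]
  constructor
  · have hH : (harmonic N : ℝ) ≤ Real.log N + γ + 1 / N := by linarith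
    have he : y * (harmonic N : ℝ) ≤ y * Real.log N + y * γ + y * (1 / N) := by
      calc y * (harmonic N : ℝ) ≤ y * (Real.log N + γ + 1 / N) :=
            mul_le_mul_of_nonneg_left hH hy0.le
        _ = y * Real.log N + y * γ + y * (1 / N) := by ring
    nlinarith
  · have hH : Real.log N + γ ≤ (harmonic N : ℝ) := by linarith
    have he : y * Real.log N + y * γ ≤ y * (harmonic N : ℝ) := by
      calc y * Real.log N + y * γ = y * (Real.log N + γ) := by ring
        _ ≤ y * (harmonic N : ℝ) := mul_le_mul_of_nonneg_left hH hy0.le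
    nlinarith

/-! ### `∑_{d ≤ x} √(x/d) ≤ 2x` and logarithms against square roots -/

/-- `∑_{n ≤ N} 1/√n ≤ 2√N` ([Apostol1976] Thm 3.2 (b) with `s = ½`, crude form; induction using
`1/√(N+1) ≤ 2(√(N+1) − √N)`). [cite: Apostol1976, Thm 3.2 (b)] -/
theorem sum_inv_sqrt_le (N : ℕ) : ∑ n ∈ Ioc 0 N, (Real.sqrt n)⁻¹ ≤ 2 * Real.sqrt N := by
  induction N with
  | zero => simp
  | succ N ih =>
    rw [Finset.sum_Ioc_succ_top (Nat.zero_le N)]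
    set a := Real.sqrt ((N + 1 : ℕ) : ℝ) with ha
    set b := Real.sqrt (N : ℝ) with hb
    have ha0 : 0 < a := Real.sqrt_pos.mpr (by positivity)
    have hb0 : 0 ≤ b := Real.sqrt_nonneg _
    have hab : b ≤ a := Real.sqrt_le_sqrt (by push_cast; linarith)
    have hsq : a ^ 2 - b ^ 2 = 1 := by
      rw [ha, hb, Real.sq_sqrt (by positivity), Real.sq_sqrt (by positivity)]
      push_cast
      ring
    have key : a⁻¹ ≤ 2 * (a - b) := by
      rw [← one_div, div_le_iff₀ ha0]
      nlinarith [mul_le_mul_of_nonneg_right (show a + b ≤ 2 * a by linarith) (sub_nonneg.mpr hab)]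
    linarith

/-- `∑_{d ≤ x} √(x/d) ≤ 2x` (the bound `O(√x ∑_{d ≤ x} 1/√d) = O(x)` in the proof of
[Apostol1976] Thm 4.18). [cite: Apostol1976, Thm 4.18 (proof)] -/
theorem sum_sqrt_div_le {x : ℝ} (hx : 0 ≤ x) :
    ∑ d ∈ Ioc 0 ⌊x⌋₊, Real.sqrt (x / d) ≤ 2 * x := by
  have h1 : ∑ d ∈ Ioc 0 ⌊x⌋₊, Real.sqrt (x / d) = Real.sqrt x * ∑ d ∈ Ioc 0 ⌊x⌋₊, (Real.sqrt d)⁻¹ := by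
    rw [Finset.mul_sum]
    refine Finset.sum_congr rfl fun d _ => ?_
    rw [Real.sqrt_div hx, div_eq_mul_inv]
  rw [h1]
  have h2 := sum_inv_sqrt_le ⌊x⌋₊
  have h3 : Real.sqrt (⌊x⌋₊ : ℝ) ≤ Real.sqrt x := Real.sqrt_le_sqrt (Nat.floor_le hx)
  have h4 : 0 ≤ Real.sqrt x := Real.sqrt_nonneg x
  calc Real.sqrt x * ∑ d ∈ Ioc 0 ⌊x⌋₊, (Real.sqrt d)⁻¹ ≤ Real.sqrt x * (2 * Real.sqrt x) := by
        apply mul_le_mul_of_nonneg_left _ h4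
        linarith
    _ = 2 * x := by rw [mul_comm, mul_assoc, Real.mul_self_sqrt hx]

/-- `log u ≤ 2√u` for `u > 0` (`log √u ≤ √u − 1`). [folklore] -/
theorem log_le_two_mul_sqrt {u : ℝ} (hu : 0 < u) : Real.log u ≤ 2 * Real.sqrt u := by
  have h1 : Real.log u = 2 * Real.log (Real.sqrt u) := by
    rw [Real.log_sqrt hu.le]; ring
  have h2 := Real.log_le_sub_one_of_pos (Real.sqrt_pos.mpr hu)
  linarith

/-- `(log u)² ≤ 16 √u` for `u ≥ 1` (`log u = 4 log u^{1/4} ≤ 4 u^{1/4}`). [folklore] -/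
theorem log_sq_le_sqrt {u : ℝ} (hu : 1 ≤ u) : Real.log u ^ 2 ≤ 16 * Real.sqrt u := by
  have hu0 : 0 < u := by linarith
  have hs0 : 0 < Real.sqrt u := Real.sqrt_pos.mpr hu0
  have h1 : Real.log u = 4 * Real.log (Real.sqrt (Real.sqrt u)) := by
    rw [Real.log_sqrt hs0.le, Real.log_sqrt hu0.le]; ring
  have h2 := Real.log_le_sub_one_of_pos (Real.sqrt_pos.mpr hs0)
  have h3 : 0 ≤ Real.log u := Real.log_nonneg hu
  have h4 : Real.log u ≤ 4 * Real.sqrt (Real.sqrt u) := by linarith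
  have h5 : 0 ≤ Real.sqrt (Real.sqrt u) := Real.sqrt_nonneg _
  calc Real.log u ^ 2 ≤ (4 * Real.sqrt (Real.sqrt u)) ^ 2 := by
        exact pow_le_pow_left₀ h3 h4 2
    _ = 16 * Real.sqrt u := by rw [mul_pow, Real.sq_sqrt hs0.le]; norm_num

/-! ### The generalised Möbius inversion of Tatuzawa–Iseki (Apostol, Thm 4.17) -/

/-- **Generalised Möbius inversion** ([Apostol1976] Thm 4.17, Tatuzawa–Iseki 1951): for any
`F : (0, ∞) → ℝ` and `x ≥ 1`, with `G(y) = log y ∑_{m ≤ y} F(y/m)`,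
`F(x) log x + ∑_{n ≤ x} Λ(n) F(x/n) = ∑_{d ≤ x} μ(d) G(x/d)`. Proof: open `∑_d μ(d) log(x/d) ∑_m`
as sums of `(μ ⋆ ζ)(n) F(x/n) = [n = 1] F(x)` and `((μ log) ⋆ ζ)(n) F(x/n) = −Λ(n) F(x/n)`
(`Literature.NumberTheory.Sieve.sum_Ioc_mul_apply_mul_eq_sum_sum`, `Literature.NumberTheory.Sieve.moebius_pmul_log`). (Apostol states it for `x > 0`;
for `x < 1` both sums are empty and the identity needs `F(x) log x = 0`, so `x ≥ 1` is assumed.)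
[cite: Apostol1976, Thm 4.17] -/
theorem moebius_inversion_log (F : ℝ → ℝ) {x : ℝ} (hx : 1 ≤ x) :
    F x * Real.log x + ∑ n ∈ Ioc 0 ⌊x⌋₊, Λ n * F (x / n) =
      ∑ d ∈ Ioc 0 ⌊x⌋₊, (μ d : ℝ) * (Real.log (x / d) *
        ∑ m ∈ Ioc 0 ⌊x / d⌋₊, F (x / d / m)) := by
  set N := ⌊x⌋₊ with hN
  have hx0 : 0 < x := by linarith
  have hN1 : 1 ≤ N := Nat.le_floor (by simpa using hx)
  set a : ℕ → ℝ := fun n => F (x / n) with ha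
  have hT : ∀ d ∈ Ioc 0 N, ∑ m ∈ Ioc 0 ⌊x / d⌋₊, F (x / d / m) =
      ∑ m ∈ Ioc 0 (N / d), (ζ : ArithmeticFunction ℝ) m * a (d * m) := by
    intro d hd
    rw [Nat.floor_div_natCast, ← hN]
    refine Finset.sum_congr rfl fun m hm => ?_
    have hm0 : m ≠ 0 := (mem_Ioc.mp hm).1.ne'
    rw [natCoe_apply, zeta_apply, if_neg hm0, Nat.cast_one, one_mul, ha]
    simp only [Nat.cast_mul, div_div]
  have h1 : ∑ d ∈ Ioc 0 N, (μ d : ℝ) * ∑ m ∈ Ioc 0 (N / d),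
      (ζ : ArithmeticFunction ℝ) m * a (d * m) = F x := by
    have := sum_Ioc_mul_apply_mul_eq_sum_sum (μ : ArithmeticFunction ℝ)
      (ζ : ArithmeticFunction ℝ) a N
    simp only [intCoe_apply] at this
    rw [← this, coe_moebius_mul_coe_zeta]
    simp only [one_apply, ite_mul, one_mul, zero_mul, Finset.sum_ite_eq', mem_Ioc]
    rw [if_pos ⟨one_pos, hN1⟩, ha]
    simp
  have h2 : ∑ d ∈ Ioc 0 N, ((μ d : ℝ) * Real.log d) * ∑ m ∈ Ioc 0 (N / d),
      (ζ : ArithmeticFunction ℝ) m * a (d * m) = -∑ n ∈ Ioc 0 N, Λ n * F (x / n) := by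
    have := sum_Ioc_mul_apply_mul_eq_sum_sum ((μ : ArithmeticFunction ℝ).pmul log)
      (ζ : ArithmeticFunction ℝ) a N
    simp only [pmul_apply, intCoe_apply, log_apply] at this
    rw [← this]
    have hconv : (μ : ArithmeticFunction ℝ).pmul log * (ζ : ArithmeticFunction ℝ) = -Λ := by
      rw [moebius_pmul_log, neg_mul, mul_assoc, coe_moebius_mul_coe_zeta, mul_one]
    rw [hconv, ← Finset.sum_neg_distrib]
    refine Finset.sum_congr rfl fun n _ => ?_
    rw [ArithmeticFunction.neg_apply, ha, neg_mul]
  symm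
  calc ∑ d ∈ Ioc 0 N, (μ d : ℝ) * (Real.log (x / d) * ∑ m ∈ Ioc 0 ⌊x / d⌋₊, F (x / d / m))
      = ∑ d ∈ Ioc 0 N, (Real.log x * ((μ d : ℝ) * ∑ m ∈ Ioc 0 (N / d),
            (ζ : ArithmeticFunction ℝ) m * a (d * m)) -
          ((μ d : ℝ) * Real.log d) * ∑ m ∈ Ioc 0 (N / d),
            (ζ : ArithmeticFunction ℝ) m * a (d * m)) := by
        refine Finset.sum_congr rfl fun d hd => ?_
        have hd0 : (0 : ℝ) < d := by exact_mod_cast (mem_Ioc.mp hd).1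
        rw [hT d hd, Real.log_div hx0.ne' hd0.ne']
        ring
    _ = F x * Real.log x + ∑ n ∈ Ioc 0 N, Λ n * F (x / n) := by
        rw [Finset.sum_sub_distrib, ← Finset.mul_sum, h1, h2]
        ring

/-! ### Selberg's asymptotic formula (Apostol, Thm 4.18) -/

/-- `∑_{m ≤ y} ψ(y/m) = log ⌊y⌋!` ([Apostol1976] Thm 4.11 / Thm 3.15: both equal
`∑_{n ≤ y} Λ(n) ⌊y/n⌋`; here via `ζ ⋆ Λ = log`). [cite: Apostol1976, Thm 4.11] -/
theorem sum_psi_div_eq_log_factorial (y : ℝ) :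
    ∑ m ∈ Ioc 0 ⌊y⌋₊, ψ (y / m) = Real.log (⌊y⌋₊ ! : ℝ) := by
  symm
  rw [log_factorial_eq_sum_log]
  have h : ∑ n ∈ Ioc 0 ⌊y⌋₊, Real.log n =
      ∑ n ∈ Ioc 0 ⌊y⌋₊, ((ζ : ArithmeticFunction ℝ) * Λ) n := by
    rw [zeta_mul_vonMangoldt]
    simp only [log_apply]
  rw [h, sum_Ioc_mul_eq_sum_sum]
  refine Finset.sum_congr rfl fun m hm => ?_
  have hm0 : m ≠ 0 := (mem_Ioc.mp hm).1.ne'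
  rw [natCoe_apply, zeta_apply, if_neg hm0, Nat.cast_one, one_mul, Chebyshev.psi,
    Nat.floor_div_natCast]

/-- The model side of [Apostol1976] Thm 4.18: with `F₂(y) = y − γ − 1`,
`|F₂(x) log x + ∑_{n ≤ x} Λ(n) F₂(x/n) − 2x log x| ≤ 20 x` for `x ≥ 1` ("rearranging terms and using
Theorem 4.9": `∑ Λ(n)(x/n − γ − 1) = x ∑ Λ(n)/n − (γ + 1) ψ(x)`, Mertens and Chebyshev).
[cite: Apostol1976, Thm 4.18 (proof)] -/
theorem selberg_modelSide_bound {x : ℝ} (hx : 1 ≤ x) :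
    |(x - Real.eulerMascheroniConstant - 1) * Real.log x +
        ∑ n ∈ Ioc 0 ⌊x⌋₊, Λ n * (x / n - Real.eulerMascheroniConstant - 1) -
        2 * x * Real.log x| ≤ 20 * x := by
  set γ := Real.eulerMascheroniConstant with hγ
  have hx0 : 0 < x := by linarith
  have hM := abs_sum_vonMangoldt_div_sub_log_le hx
  set M := ∑ n ∈ Ioc 0 ⌊x⌋₊, Λ n / n with hMdef
  have hsum : ∑ n ∈ Ioc 0 ⌊x⌋₊, Λ n * (x / n - γ - 1) = x * M - (γ + 1) * ψ x := by
    rw [hMdef, Chebyshev.psi, Finset.mul_sum, Finset.mul_sum, ← Finset.sum_sub_distrib]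
    refine Finset.sum_congr rfl fun n _ => ?_
    ring
  have hψ0 : 0 ≤ ψ x := Chebyshev.psi_nonneg x
  have hψ : ψ x ≤ (Real.log 4 + 4) * x := Chebyshev.psi_le_const_mul_self hx0.le
  have h4 := log_four_lt_two
  have hγ0 : 0 < γ := lt_trans (by norm_num) Real.one_half_lt_eulerMascheroniConstant
  have hγ23 : γ < 2 / 3 := Real.eulerMascheroniConstant_lt_two_thirds
  have hlogx_nn : 0 ≤ Real.log x := Real.log_nonneg hx
  have hlogx_le : Real.log x ≤ x := (Real.log_le_sub_one_of_pos hx0).trans (by linarith)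
  rw [hsum, abs_le]
  rw [abs_le] at hM
  obtain ⟨hM1, hM2⟩ := hM
  have e1 : x * (M - Real.log x) ≤ x * 6 := mul_le_mul_of_nonneg_left hM2 hx0.le
  have e2 : x * (-6) ≤ x * (M - Real.log x) := mul_le_mul_of_nonneg_left hM1 hx0.le
  have e3 : (γ + 1) * ψ x ≤ (γ + 1) * ((Real.log 4 + 4) * x) :=
    mul_le_mul_of_nonneg_left hψ (by linarith)
  constructor
  · nlinarith
  · nlinarith

/-- The difference of the two right members in [Apostol1976] Thm 4.18:
`|∑_{d ≤ x} μ(d) {G₁(x/d) − G₂(x/d)}| ≤ 144 x`, where `G₁ − G₂ = log y (log ⌊y⌋! − ∑_{m ≤ y}(y/m − γ − 1))`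
is bounded by `4 log y (1 + log y) ≤ 72 √y` (`abs_log_factorial_sub_sum_le`, Apostol's
"`G₁(x) − G₂(x) = O(√x)`") and `∑_{d ≤ x} √(x/d) ≤ 2x`. [cite: Apostol1976, Thm 4.18 (proof)] -/
theorem selberg_diff_bound {x : ℝ} (hx : 1 ≤ x) :
    |∑ d ∈ Ioc 0 ⌊x⌋₊, (μ d : ℝ) * (Real.log (x / d) *
        (∑ m ∈ Ioc 0 ⌊x / d⌋₊, ψ (x / d / m) -
          ∑ m ∈ Ioc 0 ⌊x / d⌋₊, (x / d / m - Real.eulerMascheroniConstant - 1)))| ≤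
      144 * x := by
  have hx0 : 0 < x := by linarith
  refine (Finset.abs_sum_le_sum_abs _ _).trans ?_
  have hterm : ∀ d ∈ Ioc 0 ⌊x⌋₊, |(μ d : ℝ) * (Real.log (x / d) *
      (∑ m ∈ Ioc 0 ⌊x / d⌋₊, ψ (x / d / m) -
        ∑ m ∈ Ioc 0 ⌊x / d⌋₊, (x / d / m - Real.eulerMascheroniConstant - 1)))| ≤
      72 * Real.sqrt (x / d) := by
    intro d hd
    obtain ⟨hd0, hdN⟩ := mem_Ioc.mp hd
    have hd0' : (0 : ℝ) < d := by exact_mod_cast hd0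
    have hdx : (d : ℝ) ≤ x := le_trans (by exact_mod_cast hdN) (Nat.floor_le hx0.le)
    have hy : 1 ≤ x / d := by rwa [le_div_iff₀ hd0', one_mul]
    have hD := abs_log_factorial_sub_sum_le hy
    rw [← sum_psi_div_eq_log_factorial (x / d)] at hD
    have hμ : |(μ d : ℝ)| ≤ 1 := by
      rw [← Int.cast_abs]
      exact_mod_cast ArithmeticFunction.abs_moebius_le_one
    have hlog0 : 0 ≤ Real.log (x / d) := Real.log_nonneg hy
    have hl1 := log_le_two_mul_sqrt (show 0 < x / d by positivity)
    have hl2 := log_sq_le_sqrt hy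
    have hs0 : 0 ≤ Real.sqrt (x / d) := Real.sqrt_nonneg _
    rw [abs_mul, abs_mul, abs_of_nonneg hlog0]
    calc |(μ d : ℝ)| * (Real.log (x / d) * |∑ m ∈ Ioc 0 ⌊x / d⌋₊, ψ (x / d / m) -
            ∑ m ∈ Ioc 0 ⌊x / d⌋₊, (x / d / m - Real.eulerMascheroniConstant - 1)|)
        ≤ 1 * (Real.log (x / d) * (4 * (1 + Real.log (x / d)))) := by
          apply mul_le_mul hμ _ (by positivity) zero_le_one
          exact mul_le_mul_of_nonneg_left hD hlog0
      _ = 4 * Real.log (x / d) + 4 * Real.log (x / d) ^ 2 := by ring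
      _ ≤ 4 * (2 * Real.sqrt (x / d)) + 4 * (16 * Real.sqrt (x / d)) := by
          gcongr
      _ = 72 * Real.sqrt (x / d) := by ring
  calc ∑ d ∈ Ioc 0 ⌊x⌋₊, |(μ d : ℝ) * (Real.log (x / d) *
          (∑ m ∈ Ioc 0 ⌊x / d⌋₊, ψ (x / d / m) -
            ∑ m ∈ Ioc 0 ⌊x / d⌋₊, (x / d / m - Real.eulerMascheroniConstant - 1)))|
      ≤ ∑ d ∈ Ioc 0 ⌊x⌋₊, 72 * Real.sqrt (x / d) := Finset.sum_le_sum hterm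
    _ = 72 * ∑ d ∈ Ioc 0 ⌊x⌋₊, Real.sqrt (x / d) := by rw [Finset.mul_sum]
    _ ≤ 72 * (2 * x) := by
        have := sum_sqrt_div_le hx0.le
        linarith
    _ = 144 * x := by ring

/-- **Selberg's asymptotic formula** ([Apostol1976] Thm 4.18: "for `x > 0` we have
`ψ(x) log x + ∑_{n ≤ x} Λ(n) ψ(x/n) = 2x log x + O(x)`"; A. Selberg, Ann. of Math. (2) 50 (1949)
305–313), explicit form: `|ψ(x) log x + ∑_{n ≤ x} Λ(n) ψ(x/n) − 2x log x| ≤ 164 x` for `x ≥ 1`.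
Proof as in Apostol: apply `moebius_inversion_log` to `F₁ = ψ` and `F₂(y) = y − γ − 1` and subtract
(`selberg_diff_bound`, `selberg_modelSide_bound`). [cite: Apostol1976, Thm 4.18] -/
theorem selberg_symmetry_formula {x : ℝ} (hx : 1 ≤ x) :
    |ψ x * Real.log x + ∑ n ∈ Ioc 0 ⌊x⌋₊, Λ n * ψ (x / n) - 2 * x * Real.log x| ≤ 164 * x := by
  have e1 := moebius_inversion_log ψ hx
  have e2 := moebius_inversion_log (fun y => y - Real.eulerMascheroniConstant - 1) hx
  have hB := selberg_modelSide_bound hx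
  have hD := selberg_diff_bound hx
  have hdiff : ∑ d ∈ Ioc 0 ⌊x⌋₊, (μ d : ℝ) * (Real.log (x / d) *
        ∑ m ∈ Ioc 0 ⌊x / d⌋₊, ψ (x / d / m)) -
      ∑ d ∈ Ioc 0 ⌊x⌋₊, (μ d : ℝ) * (Real.log (x / d) *
        ∑ m ∈ Ioc 0 ⌊x / d⌋₊, (x / d / m - Real.eulerMascheroniConstant - 1)) =
      ∑ d ∈ Ioc 0 ⌊x⌋₊, (μ d : ℝ) * (Real.log (x / d) *
        (∑ m ∈ Ioc 0 ⌊x / d⌋₊, ψ (x / d / m) -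
          ∑ m ∈ Ioc 0 ⌊x / d⌋₊, (x / d / m - Real.eulerMascheroniConstant - 1))) := by
    rw [← Finset.sum_sub_distrib]
    refine Finset.sum_congr rfl fun d _ => ?_
    ring
  rw [abs_le] at hB hD ⊢
  constructor
  · linarith [hdiff, e1, e2, hB.1, hD.1]
  · linarith [hdiff, e1, e2, hB.2, hD.2]

/-! ### The form `∑ Λ(n) log n + ∑ (Λ ⋆ Λ)(n) = 2x log x + O(x)` and `Λ₂` -/

/-- **Partial summation against `log`.** For coefficients `c` with `c 0 = 0` and partial sums
`C(t) = ∑_{n ≤ t} c(n)`: `∑_{n ≤ x} c(n) log n = C(x) log x − ∫_1^x C(t) dt/t` (Abel summation,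
Mathlib's `sum_mul_eq_sub_integral_mul₀` with `f = log`, `f' = 1/t`). [folklore] -/
theorem sum_mul_log_eq (c : ℕ → ℝ) (hc : c 0 = 0) (x : ℝ) :
    ∑ n ∈ Ioc 0 ⌊x⌋₊, c n * Real.log n =
      (∑ n ∈ Ioc 0 ⌊x⌋₊, c n) * Real.log x -
        ∫ t in Set.Ioc 1 x, (∑ n ∈ Ioc 0 ⌊t⌋₊, c n) / t := by
  have hIcc : ∀ m : ℕ, ∑ k ∈ Icc 0 m, c k = ∑ k ∈ Ioc 0 m, c k := fun m => by
    rw [← add_sum_Ioc_eq_sum_Icc (Nat.zero_le _), hc, zero_add]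
  have hdiff : ∀ t ∈ Set.Icc 1 x, DifferentiableAt ℝ Real.log t :=
    fun t ht => Real.differentiableAt_log (by linarith [ht.1] : (0 : ℝ) < t).ne'
  have hint : IntegrableOn (deriv Real.log) (Set.Icc 1 x) := by
    have hc : ContinuousOn (fun t : ℝ => t⁻¹) (Set.Icc 1 x) :=
      continuousOn_inv₀.mono fun t ht =>
        Set.mem_compl_singleton_iff.mpr (by linarith [ht.1] : (0 : ℝ) < t).ne'
    refine (hc.integrableOn_compact isCompact_Icc).congr_fun (fun t _ => ?_) measurableSet_Icc
    rw [Real.deriv_log]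
  have h := sum_mul_eq_sub_integral_mul₀ c hc x hdiff hint
  have hI : ∫ t in Set.Ioc 1 x, deriv Real.log t * ∑ k ∈ Icc 0 ⌊t⌋₊, c k =
      ∫ t in Set.Ioc 1 x, (∑ n ∈ Ioc 0 ⌊t⌋₊, c n) / t := by
    refine setIntegral_congr_fun measurableSet_Ioc fun t _ => ?_
    rw [Real.deriv_log, hIcc, div_eq_inv_mul]
  rw [hI, hIcc] at h
  have hL : ∑ k ∈ Icc 0 ⌊x⌋₊, Real.log k * c k = ∑ n ∈ Ioc 0 ⌊x⌋₊, c n * Real.log n := by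
    rw [← add_sum_Ioc_eq_sum_Icc (Nat.zero_le _)]
    simp only [Nat.cast_zero, Real.log_zero, zero_mul, zero_add]
    exact Finset.sum_congr rfl fun n _ => mul_comm _ _
  rw [← hL, h, mul_comm]

/-- The integral of Abel summation against `log` for nonnegative partial sums of linear growth:
if `0 ≤ C(t) ≤ K t` on `(1, x]` then `0 ≤ ∫_1^x C(t) dt/t ≤ K (x − 1)` (no integrability
needed: Mathlib's `norm_setIntegral_le_of_norm_le_const`). [folklore] -/
theorem setIntegral_div_bounds {C : ℝ → ℝ} {K x : ℝ} (hx : 1 ≤ x)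
    (h0 : ∀ t ∈ Set.Ioc 1 x, 0 ≤ C t) (hK : ∀ t ∈ Set.Ioc 1 x, C t ≤ K * t) :
    0 ≤ ∫ t in Set.Ioc 1 x, C t / t ∧ ∫ t in Set.Ioc 1 x, C t / t ≤ K * (x - 1) := by
  constructor
  · exact setIntegral_nonneg measurableSet_Ioc fun t ht =>
      div_nonneg (h0 t ht) (by linarith [ht.1])
  · have h : ‖∫ t in Set.Ioc 1 x, C t / t‖ ≤ K * volume.real (Set.Ioc 1 x) :=
      norm_setIntegral_le_of_norm_le_const measure_Ioc_lt_top fun t ht => by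
        have ht0 : 0 < t := by linarith [ht.1]
        rw [Real.norm_eq_abs, abs_of_nonneg (div_nonneg (h0 t ht) ht0.le), div_le_iff₀ ht0]
        exact hK t ht
    rw [Real.norm_eq_abs, Real.volume_real_Ioc_of_le hx] at h
    exact (le_abs_self _).trans h

/-- `∑_{n ≤ x} Λ(n) log n = ψ(x) log x − ∫_1^x ψ(t) dt/t` (partial summation). [folklore] -/
theorem sum_vonMangoldt_mul_log_eq (x : ℝ) :
    ∑ n ∈ Ioc 0 ⌊x⌋₊, Λ n * Real.log n =
      ψ x * Real.log x - ∫ t in Set.Ioc 1 x, ψ t / t := by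
  rw [sum_mul_log_eq (fun n => Λ n) (by simp) x, Chebyshev.psi]
  rfl

/-- `0 ≤ ∫_1^x ψ(t) dt/t ≤ (log 4 + 4) x` for `x ≥ 1`, from Chebyshev's bound
`ψ(t) ≤ (log 4 + 4) t` (Mathlib's `Chebyshev.psi_le_const_mul_self`). [folklore] -/
theorem integral_psi_div_bounds {x : ℝ} (hx : 1 ≤ x) :
    0 ≤ ∫ t in Set.Ioc 1 x, ψ t / t ∧ ∫ t in Set.Ioc 1 x, ψ t / t ≤ (Real.log 4 + 4) * x := by
  have h := setIntegral_div_bounds (C := ψ) (K := Real.log 4 + 4) hx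
    (fun t _ => Chebyshev.psi_nonneg t)
    (fun t ht => Chebyshev.psi_le_const_mul_self (by linarith [ht.1]))
  have h4 : 0 ≤ Real.log 4 := Real.log_nonneg (by norm_num)
  exact ⟨h.1, h.2.trans (by nlinarith)⟩

/-- `∑_{n ≤ x} (Λ ⋆ Λ)(n) = ∑_{d ≤ x} Λ(d) ψ(x/d)` (Dirichlet's rearrangement, Mathlib's
`ArithmeticFunction.sum_Ioc_mul_eq_sum_sum`). [folklore] -/
theorem sum_vonMangoldt_mul_vonMangoldt_eq (x : ℝ) :
    ∑ n ∈ Ioc 0 ⌊x⌋₊, (Λ * Λ) n = ∑ d ∈ Ioc 0 ⌊x⌋₊, Λ d * ψ (x / d) := by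
  rw [sum_Ioc_mul_eq_sum_sum]
  refine Finset.sum_congr rfl fun d _ => ?_
  rw [Chebyshev.psi, Nat.floor_div_natCast]

/-- **Selberg's formula, second form**: `|∑_{n ≤ x} Λ(n) log n + ∑_{n ≤ x} (Λ ⋆ Λ)(n) − 2x log x| ≤ 170 x`
for `x ≥ 1` (from `selberg_symmetry_formula` by `∑ Λ(n) log n = ψ(x) log x − ∫_1^x ψ(t) dt/t`,
`0 ≤ ∫ ≤ (log 4 + 4) x`; cf. [Apostol1976] §4.11 and Selberg 1949 (1.2)).
[cite: Apostol1976, Thm 4.18] -/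
theorem selberg_symmetry_formula' {x : ℝ} (hx : 1 ≤ x) :
    |∑ n ∈ Ioc 0 ⌊x⌋₊, Λ n * Real.log n + ∑ n ∈ Ioc 0 ⌊x⌋₊, (Λ * Λ) n -
        2 * x * Real.log x| ≤ 170 * x := by
  rw [sum_vonMangoldt_mul_log_eq x, sum_vonMangoldt_mul_vonMangoldt_eq]
  have h1 := selberg_symmetry_formula hx
  have h2 := integral_psi_div_bounds hx
  have h4 := log_four_lt_two
  have hx0 : 0 < x := by linarith
  rw [abs_le] at h1 ⊢
  constructor
  · nlinarith [h2.1, h2.2, h1.1]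
  · nlinarith [h2.1, h2.2, h1.2]

/-- **Selberg's formula for `Λ₂ = Λ log + Λ ⋆ Λ`** (`Literature.generalizedVonMangoldt 2`,
`generalizedVonMangoldt_succ`): `|∑_{n ≤ x} Λ₂(n) − 2x log x| ≤ 170 x` for `x ≥ 1` — the case `k = 2`
of [FriedlanderIwaniecPisa1978] Lemma 3 for the integers, with an explicit constant.
[cite: Apostol1976, Thm 4.18] [cite: FriedlanderIwaniecPisa1978, Lemma 3 (k = 2, K = Q)] -/
theorem abs_sum_generalizedVonMangoldt_two_sub_le {x : ℝ} (hx : 1 ≤ x) :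
    |∑ n ∈ Ioc 0 ⌊x⌋₊, generalizedVonMangoldt 2 n - 2 * x * Real.log x| ≤ 170 * x := by
  have h : ∀ n ∈ Ioc 0 ⌊x⌋₊, generalizedVonMangoldt 2 n = Λ n * Real.log n + (Λ * Λ) n := by
    intro n _
    rw [show (2 : ℕ) = 1 + 1 from rfl, generalizedVonMangoldt_succ, generalizedVonMangoldt_one,
      ArithmeticFunction.add_apply, pmul_apply, log_apply]
  rw [Finset.sum_congr rfl h, Finset.sum_add_distrib]
  exact selberg_symmetry_formula' hx

end SelbergSymmetry

end Literature.NumberTheory.Sieve
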